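import Summits.Parity.GeneralizedHardyLittlewood.Theses.LiouvilleShiftedTables
import Literature.NumberTheory.Sieve.BombieriFriedlanderIwaniecPartition

/-!
# Sieve glue for `SieveToMAvg` (route `LiouvilleShiftedTables`), part 1: the correlation functional

Support file for item stmt-Parity-14274
(`Summit.Parity.GeneralizedHardyLittlewood.Theses.LiouvilleShiftedTables.SieveToMAvg`:
`DilatedTableChowla → TypeI2Dilated → BVLiouville → MAvg`).

The whole glue estimates, for a weight `w` (later `w n = λ(n − h)`), a shift `h`, a level `Q` and a
dyadic scale `x`, the seminorm

  `TT w h Q x F = ∑_{q ≤ Q, (q,h)=1} |∑_{x < n ≤ 2x, n ≡ h (mod q)} F(n) w(n)|`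

of a sequence `F` (the von Mangoldt function, then its Heath-Brown pieces, then boxed products).
This file records the functional and its formal properties: subadditivity, absolute homogeneity,
dependence on `F ↾ (x, 2x]` only, and the trivial bound.
-/

namespace Summit.Parity.GeneralizedHardyLittlewood.Theorems.SieveToMAvg

open Finset Real

/-- The moduli of the functional: `1 ≤ q ≤ Q` with `(q, h) = 1`. [folklore] -/
def moduli (Q h : ℕ) : Finset ℕ := (Icc 1 Q).filter (fun q : ℕ => Nat.Coprime q h)

/-- Membership in `moduli`. [folklore] -/
theorem mem_moduli {Q h q : ℕ} : q ∈ moduli Q h ↔ (1 ≤ q ∧ q ≤ Q) ∧ Nat.Coprime q h := by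
  simp [moduli]

/-- The dyadic range `(x, 2x]` intersected with the class `h (mod q)`. [folklore] -/
noncomputable def dyadClass (h q : ℕ) (x : ℝ) : Finset ℕ :=
  (Ioc ⌊x⌋₊ ⌊2 * x⌋₊).filter (fun n : ℕ => n ≡ h [MOD q])

/-- Membership in `dyadClass`. [folklore] -/
theorem mem_dyadClass {h q : ℕ} {x : ℝ} {n : ℕ} :
    n ∈ dyadClass h q x ↔ (⌊x⌋₊ < n ∧ n ≤ ⌊2 * x⌋₊) ∧ n ≡ h [MOD q] := by
  simp [dyadClass]

/-- The inner correlation sum `∑_{x < n ≤ 2x, n ≡ h (q)} F(n) w(n)`. [folklore] -/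
noncomputable def corr (w : ℕ → ℝ) (h q : ℕ) (x : ℝ) (F : ℕ → ℝ) : ℝ :=
  ∑ n ∈ dyadClass h q x, F n * w n

/-- The correlation functional
`TT w h Q x F = ∑_{q ≤ Q, (q,h)=1} |∑_{x < n ≤ 2x, n ≡ h (q)} F(n) w(n)|`. [folklore] -/
noncomputable def TT (w : ℕ → ℝ) (h Q : ℕ) (x : ℝ) (F : ℕ → ℝ) : ℝ :=
  ∑ q ∈ moduli Q h, |corr w h q x F|

section Basic

variable (w : ℕ → ℝ) (h Q : ℕ) (x : ℝ)

/-- `corr` is additive in `F`. [folklore] -/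
theorem corr_add (q : ℕ) (F G : ℕ → ℝ) :
    corr w h q x (fun n => F n + G n) = corr w h q x F + corr w h q x G := by
  unfold corr
  rw [← Finset.sum_add_distrib]
  exact Finset.sum_congr rfl fun n _ => by ring

/-- `corr` is homogeneous in `F`. [folklore] -/
theorem corr_smul (q : ℕ) (c : ℝ) (F : ℕ → ℝ) :
    corr w h q x (fun n => c * F n) = c * corr w h q x F := by
  unfold corr
  rw [Finset.mul_sum]
  exact Finset.sum_congr rfl fun n _ => by ring

/-- `corr` is linear over finite sums with coefficients. [folklore] -/
theorem corr_sum {ι : Type*} (s : Finset ι) (c : ι → ℝ) (F : ι → ℕ → ℝ) (q : ℕ) :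
    corr w h q x (fun n => ∑ i ∈ s, c i * F i n) = ∑ i ∈ s, c i * corr w h q x (F i) := by
  classical
  induction s using Finset.induction_on with
  | empty => simp [corr]
  | @insert i s hi ih =>
    simp only [Finset.sum_insert hi]
    rw [← ih, ← corr_smul, ← corr_add]

/-- `corr` only sees `F` on `(x, 2x]`. [folklore] -/
theorem corr_congr {F G : ℕ → ℝ} (hFG : ∀ n ∈ Ioc ⌊x⌋₊ ⌊2 * x⌋₊, F n = G n) (q : ℕ) :
    corr w h q x F = corr w h q x G := by
  unfold corr
  refine Finset.sum_congr rfl fun n hn => ?_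
  rw [hFG n (Finset.mem_of_mem_filter n hn)]

/-- The trivial bound on `corr` for `|w| ≤ 1`. [folklore] -/
theorem abs_corr_le (hw : ∀ n, |w n| ≤ 1) (q : ℕ) (F : ℕ → ℝ) :
    |corr w h q x F| ≤ ∑ n ∈ dyadClass h q x, |F n| := by
  unfold corr
  refine (Finset.abs_sum_le_sum_abs _ _).trans (Finset.sum_le_sum fun n _ => ?_)
  rw [abs_mul]
  exact (mul_le_mul_of_nonneg_left (hw n) (abs_nonneg _)).trans_eq (mul_one _)

/-- `TT ≥ 0`. [folklore] -/
theorem TT_nonneg (F : ℕ → ℝ) : 0 ≤ TT w h Q x F :=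
  Finset.sum_nonneg fun _ _ => abs_nonneg _

/-- Subadditivity of `TT`. [folklore] -/
theorem TT_add_le (F G : ℕ → ℝ) :
    TT w h Q x (fun n => F n + G n) ≤ TT w h Q x F + TT w h Q x G := by
  unfold TT
  rw [← Finset.sum_add_distrib]
  exact Finset.sum_le_sum fun q _ => by rw [corr_add]; exact abs_add_le _ _

/-- Absolute homogeneity of `TT`. [folklore] -/
theorem TT_smul (c : ℝ) (F : ℕ → ℝ) :
    TT w h Q x (fun n => c * F n) = |c| * TT w h Q x F := by
  unfold TT
  rw [Finset.mul_sum]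
  exact Finset.sum_congr rfl fun q _ => by rw [corr_smul, abs_mul]

/-- `TT` of a finite linear combination is at most the combination of the `TT`s with absolute
coefficients. [folklore] -/
theorem TT_sum_le {ι : Type*} (s : Finset ι) (c : ι → ℝ) (F : ι → ℕ → ℝ) :
    TT w h Q x (fun n => ∑ i ∈ s, c i * F i n) ≤ ∑ i ∈ s, |c i| * TT w h Q x (F i) := by
  unfold TT
  calc ∑ q ∈ moduli Q h, |corr w h q x fun n => ∑ i ∈ s, c i * F i n|
      = ∑ q ∈ moduli Q h, |∑ i ∈ s, c i * corr w h q x (F i)| := by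
        refine Finset.sum_congr rfl fun q _ => ?_; rw [corr_sum]
    _ ≤ ∑ q ∈ moduli Q h, ∑ i ∈ s, |c i| * |corr w h q x (F i)| := by
        refine Finset.sum_le_sum fun q _ => (Finset.abs_sum_le_sum_abs _ _).trans ?_
        exact Finset.sum_le_sum fun i _ => by rw [abs_mul]
    _ = ∑ i ∈ s, |c i| * ∑ q ∈ moduli Q h, |corr w h q x (F i)| := by
        rw [Finset.sum_comm]
        exact Finset.sum_congr rfl fun i _ => by rw [Finset.mul_sum]

/-- `TT` of an unweighted finite sum. [folklore] -/
theorem TT_sum_le' {ι : Type*} (s : Finset ι) (F : ι → ℕ → ℝ) :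
    TT w h Q x (fun n => ∑ i ∈ s, F i n) ≤ ∑ i ∈ s, TT w h Q x (F i) := by
  have := TT_sum_le w h Q x s (fun _ => (1 : ℝ)) F
  simpa only [one_mul, abs_one] using this

/-- `TT` only sees `F` on `(x, 2x]`. [folklore] -/
theorem TT_congr {F G : ℕ → ℝ} (hFG : ∀ n ∈ Ioc ⌊x⌋₊ ⌊2 * x⌋₊, F n = G n) :
    TT w h Q x F = TT w h Q x G := by
  unfold TT
  exact Finset.sum_congr rfl fun q _ => by rw [corr_congr w h x hFG]

/-- Monotonicity of the trivial majorant: if `|F| ≤ G` on `(x, 2x]` and `|w| ≤ 1` then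
`TT F ≤ ∑_{q} ∑_{n ∈ dyadClass} G(n)`. [folklore] -/
theorem TT_le_sum_sum (hw : ∀ n, |w n| ≤ 1) {F G : ℕ → ℝ}
    (hFG : ∀ n ∈ Ioc ⌊x⌋₊ ⌊2 * x⌋₊, |F n| ≤ G n) :
    TT w h Q x F ≤ ∑ q ∈ moduli Q h, ∑ n ∈ dyadClass h q x, G n := by
  unfold TT
  refine Finset.sum_le_sum fun q _ => (abs_corr_le w h x hw q F).trans ?_
  exact Finset.sum_le_sum fun n hn => hFG n (Finset.mem_of_mem_filter n hn)

end Basic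

/-! ### Counting the moduli `q ≤ Q` dividing `n − h` -/

/-- For `n > h`, the number of `q ∈ moduli Q h` with `n ≡ h (mod q)` is at most `τ(n − h)`. [folklore] -/
theorem card_moduli_filter_modEq_le {Q h n : ℕ} (hn : h < n) :
    ((moduli Q h).filter (fun q => n ≡ h [MOD q])).card ≤ ArithmeticFunction.sigma 0 (n - h) := by
  rw [ArithmeticFunction.sigma_zero_apply]
  refine Finset.card_le_card fun q hq => ?_
  rw [Finset.mem_filter, mem_moduli] at hq
  rw [Nat.mem_divisors]
  refine ⟨?_, by omega⟩
  exact (Nat.modEq_iff_dvd' hn.le).1 hq.2.symm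

/-- Swapping the two sums of the trivial majorant: for `G ≥ 0`,
`∑_{q ∈ moduli} ∑_{n ∈ dyadClass h q x} G(n) = ∑_{x<n≤2x} G(n) · #{q ∈ moduli : n ≡ h (q)}`. [folklore] -/
theorem sum_moduli_sum_dyadClass_eq (h Q : ℕ) (x : ℝ) (G : ℕ → ℝ) :
    ∑ q ∈ moduli Q h, ∑ n ∈ dyadClass h q x, G n =
      ∑ n ∈ Ioc ⌊x⌋₊ ⌊2 * x⌋₊, (((moduli Q h).filter (fun q => n ≡ h [MOD q])).card : ℝ) * G n := by
  unfold dyadClass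
  simp_rw [Finset.sum_filter]
  rw [Finset.sum_comm]
  refine Finset.sum_congr rfl fun n _ => ?_
  rw [Finset.card_filter, Nat.cast_sum, Finset.sum_mul]
  refine Finset.sum_congr rfl fun q _ => ?_
  split_ifs <;> simp

/-- The trivial bound with the divisor function: if `|w| ≤ 1`, `|F| ≤ G` with `G ≥ 0` on `(x,2x]`, and
`h ≤ x`, then `TT w h Q x F ≤ ∑_{x < n ≤ 2x} τ(n − h) G(n)`. [folklore] -/
theorem TT_le_sum_sigma (w : ℕ → ℝ) (h Q : ℕ) {x : ℝ} (hw : ∀ n, |w n| ≤ 1) (hx : (h : ℝ) ≤ x)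
    {F G : ℕ → ℝ} (hFG : ∀ n ∈ Ioc ⌊x⌋₊ ⌊2 * x⌋₊, |F n| ≤ G n) :
    TT w h Q x F ≤ ∑ n ∈ Ioc ⌊x⌋₊ ⌊2 * x⌋₊, (ArithmeticFunction.sigma 0 (n - h) : ℝ) * G n := by
  refine (TT_le_sum_sum w h Q x hw hFG).trans ?_
  rw [sum_moduli_sum_dyadClass_eq]
  refine Finset.sum_le_sum fun n hn => ?_
  have hG : 0 ≤ G n := (abs_nonneg _).trans (hFG n hn)
  refine mul_le_mul_of_nonneg_right ?_ hG
  have hxn : h < n := by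
    have h1 := (Finset.mem_Ioc.1 hn).1
    have : (h : ℕ) ≤ ⌊x⌋₊ := Nat.le_floor hx
    omega
  exact_mod_cast card_moduli_filter_modEq_le hxn

end Summit.Parity.GeneralizedHardyLittlewood.Theorems.SieveToMAvg
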